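import Summits.BirchSwinnertonDyer.BirchSwinnertonDyer.Theses.AdditiveKolyvaginRoad
import Summits.BirchSwinnertonDyer.Rank1Residual.X11b.BDPRoute
import Literature.NumberTheory.EllipticCurves.KuriharaNumber
import Literature.NumberTheory.EllipticCurves.CuspFormLFunction
import Literature.NumberTheory.EllipticCurves.Zhai2016.NonvanishingQuadraticTwists

/-!
# Sketch — crux idea `tame-gross-zagier-kk-prime` (crux 21396 `LevelKolyvaginSystemsAdditive`,
  engine for the OPEN stub S5 `BdpRebase.stub_indexLowerBoundAdditive` of the live line `bdp-rebase`)

BSD is not proved by this.  Nothing here is a theorem of the tree: the file types (i) the notion of an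
INERT KATO–KOLYVAGIN PRIME `ℓ` of level `p^k` for the frame `(E, p, K)`, (ii) the INTERFACE of a tame
(`ℤ/p^k`-valued, Bockstein / Mazur–Tate type) height on `E(K)` attached to the tamely ramified
extension `K(μ_ℓ)⁽ᵖᵏ⁾/K` — posited as DATA with its one structural law (quadratic scaling), its
CONSTRUCTION (Nekovář, Selmer complexes §11 / Mazur–Tate 1987) being a separate definition request —,
(iii) the conjectural TAME GROSS–ZAGIER identity `TGZ_ℓ` at such a prime, stated over the tree's
`kuriharaNumber` (Mazur–Tate derivative `δ_ℓ(f)`) and `kuriharaNumber · 1 = [0]⁺` of the twisted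
newform (`= L(E^{d_K},1)/Ω⁺`), and (iv) the FIRST LEMMA of the line: the elementary squeeze
`TGZ_ℓ` + (Kato-leg exact orders at one inert KK prime) + (Ш-decomposition bound) ⟹
`X11b.IndexLowerBoundAt W p K y` (S5's conclusion), an S-sized statement provable now.
-/

set_option linter.dupNamespace false

noncomputable section

open scoped Classical

open WeierstrassCurve NumberField
  Literature.NumberTheory.EllipticCurves Literature.NumberTheory.EllipticCurves.ModularForms
  Literature.NumberTheory.EllipticCurves.Rank1Residual Literature.NumberTheory.GaloisRepresentations
  Summit.BirchSwinnertonDyer.BirchSwinnertonDyer.Theses.AdditiveKolyvaginRoad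

namespace Summit.BirchSwinnertonDyer.BirchSwinnertonDyer.Cruxes.LevelKolyvaginSystemsAdditive.TameGrossZagier

/-- An **inert Kato–Kolyvagin prime of level `p^k`** for the frame `(W, K, p)`: a prime `ℓ ∤ Np`,
`ℓ ≡ 1 (mod p^k)`, `a_ℓ(W) ≡ ℓ + 1 (mod p^k)` (so `p^k ∣ #W̃(𝔽_ℓ)` and `Frob_ℓ` is unipotent mod `p^k`),
`Frob_ℓ` NON-SCALAR mod `p` (recorded as: `p²` does not divide `#W̃(𝔽_ℓ)` when `k = 1`-type cyclicity is
needed downstream — kept out of this predicate and imposed where used), and `ℓ` INERT in `K`.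
These are the primes of Kato's/Kurihara's Kolyvagin systems (`ℓ ≡ +1`), not Kolyvagin's Heegner primes
(`ℓ` inert with `a_ℓ ≡ ℓ + 1 ≡ 0`): here `ℓ ≡ 1`, and inertness in `K` is an extra Chebotarev condition,
compatible because `K ∩ ℚ(W[p^k]) = ℚ` for `d_K` prime to `pN`. -/
def InertKatoKolyvaginPrime (W : WeierstrassCurve ℚ) [W.IsGloballyMinimal] (K : Type) [Field K]
    [NumberField K] (p k ℓ : ℕ) : Prop :=
  ℓ.Prime ∧ ℓ ≠ p ∧ ¬ ℓ ∣ W.conductorNorm ℤ ∧ p ^ k ∣ ℓ - 1 ∧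
    (p ^ k : ℤ) ∣ (ℓ : ℤ) + 1 - W.frobeniusTrace ℓ ∧
    Literature.NumberTheory.EllipticCurves.Zhai2016.IsInertIn K ℓ

/-- INTERFACE (posited object; its construction is a separate definition request, never assumed here):
a **tame height** on `E(K)` with values in `ℤ/m` — in the intended instance `m = p^k` and the height is
Nekovář's Bockstein pairing `h^{(ℓ)}_K` for the `ℤ/p^k`-extension inside `K(μ_ℓ)/K` (unramified local
condition at `λ = ℓ𝓞_K`), read in `ℤ/p^k` through a discrete logarithm `ψ_ℓ : (ℤ/ℓ)ˣ ↠ ℤ/p^k`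
(`Gal(K(μ_ℓ)/K) = (ℤ/ℓ)ˣ` as `ℓ` is inert). Only the law the squeeze uses is recorded: quadratic
scaling and torsion-translation invariance of the diagonal value `P ↦ h(P, P)`. -/
structure TameHeight (W : WeierstrassCurve ℚ) (K : Type) [Field K] [NumberField K] (m : ℕ) where
  /-- the diagonal value `P ↦ h(P, P) ∈ ℤ/m` -/
  toFun : (W.baseChange K).toAffine.Point → ZMod m
  /-- `h(nP, nP) = n² h(P, P)` -/
  map_zsmul : ∀ (n : ℤ) (P : (W.baseChange K).toAffine.Point),
    toFun (n • P) = ((n : ZMod m) ^ 2) * toFun P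
  /-- `h` factors through `E(K)/torsion` -/
  map_add_of_isOfFinAddOrder : ∀ (T P : (W.baseChange K).toAffine.Point),
    IsOfFinAddOrder T → toFun (T + P) = toFun P

/-- "`p^j` exactly divides `x` in `ℤ/m`" (meaningful for `j < ord_p m`). -/
def ExactPPow (p j : ℕ) {m : ℕ} (x : ZMod m) : Prop :=
  (p ^ j : ZMod m) ∣ x ∧ ¬ (p ^ (j + 1) : ZMod m) ∣ x

/-- **`TGZ_ℓ` — the tame Gross–Zagier identity at an inert Kato–Kolyvagin prime (CONJECTURAL; the
card's lever).** For the frame's Heegner point `y = y_K ∈ E(K)` (the point mapping to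
`heegnerPointComplex Dt H` under `ι`), the newform `f` of `E` and `f^d` of the twist `E^{d_K}`, a level
`p^k`, an inert KK prime `ℓ`, a surjective discrete log `ψ_ℓ` and the tame height `h = h^{(ℓ)}_K` read
through `ψ_ℓ`:  `h(y, y) = u · δ_ℓ(f) · δ_1(f^d)` in `ℤ/p^k` for a unit `u`
(`δ_ℓ(f) = kuriharaNumber f (p^k) ℓ ψ` = the first Mazur–Tate derivative of `θ_{E,ℓ}`;
`δ_1(f^d) = [0]⁺_{f^d} = L(E^d,1)/Ω⁺_{f^d}`, `kuriharaNumber_one`). Informally: the leading Mazur–Tate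
coefficient of `θ_{E/K, K(μ_ℓ)} = θ_{E,ℓ} θ_{E^d,ℓ}` equals the tame height of the Heegner point — the
rank-one Mazur–Tate conjecture over `K` in the cyclotomic-tame direction with the BSD quotient
substituted, hence Ш-FREE and INDEX-FREE (Gross–Zagier shape). The unit `u` absorbs `u_K², c_{Manin}`,
`#E(K)_{tors}`, powers of `2` and the period ratio `Ω⁺_f Ω⁺_{f^d} / (‖ω_f‖²/√|d_K|)`, all prime to
`p ≥ 5` on the frame. -/
def TameGrossZagierAt (W : WeierstrassCurve ℚ) [W.IsElliptic] [W.IsGloballyMinimal]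
    [NeZero (W.conductorNorm ℤ)] (p : ℕ) [Fact p.Prime] (K : Type) [Field K] [NumberField K]
    (Dt : ModularParametrizationData W (W.conductorNorm ℤ)) (ι : K →+* ℂ)
    {N Nd : ℕ} [NeZero N] [NeZero Nd] (f : CuspForm (CongruenceSubgroup.Gamma0 N) 2)
    (fd : CuspForm (CongruenceSubgroup.Gamma0 Nd) 2) (k ℓ : ℕ) [NeZero ℓ]
    (ψ : (q : ℕ) → (ZMod q)ˣ →* Multiplicative (ZMod (p ^ k))) (h : TameHeight W K (p ^ k))
    (H : HeegnerDatum (W.conductorNorm ℤ) (NumberField.discr K))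
    (y : (W.baseChange K).toAffine.Point) : Prop :=
  IsNewformOf W f → IsNewformOf (W.quadraticTwist (NumberField.discr K : ℚ)) fd →
    InertKatoKolyvaginPrime W K p k ℓ → Function.Surjective (ψ ℓ) →
    WeierstrassCurve.Affine.Point.map ι.toRatAlgHom y = heegnerPointComplex Dt H →
    ∃ u : (ZMod (p ^ k))ˣ,
      h.toFun y = (u : ZMod (p ^ k)) * kuriharaNumber f (p ^ k) ℓ ψ * kuriharaNumber fd (p ^ k) 1 ψ

/-- **FIRST LEMMA of the line (elementary squeeze; S-sized, provable now).** On S5's frame, let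
`y = y_K`, `P₀ ∈ E(K)` (the image of a generator of `E(ℚ)/tors`) with `y = I • P₀ + T`, `T` torsion,
`ord_p [E(K) : ℤy] = ord_p I`. Suppose at ONE level `k` and ONE inert KK prime `ℓ` with surjective `ψ_ℓ`:
`TGZ_ℓ` holds for the tame height `h`; the KATO LEG gives the exact orders `p^s ∥ δ_ℓ(f)` with
`s = ord_p #Ш(E/ℚ)[p^∞]` (Kim–Kurihara structure theorem, inert-restricted, `𝓜_∞ = ord_p Tam(E) = 0`
on the frame) and `h(P₀, P₀)` a unit (same Chebotarev condition: `P̃₀` generates `Ẽ(𝔽_λ) ⊗ ℤ/p`), and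
`p^t ∥ δ_1(f^d)` with `t = ord_p #Ш(E^d/ℚ)[p^∞]` (rank-0 BSD_p for the twist on the FW locus,
`p ∤ Tam(E^d)`); `s + t < k`, `2 ord_p I < k`; and `s + t ≤ ord_p #Ш(E/K)` (`Ш(E/K)[p^∞] =
Ш(E)[p^∞] ⊕ Ш(E^d)[p^∞]`, `p` odd). THEN `2 ord_p I = s + t`, whence S5's conclusion
`X11b.IndexLowerBoundAt W p K y`. (Pure `ℤ/p^k` bookkeeping: `I² · unit = unit · δ_ℓ · δ_1`.) -/
def FirstLemma : Prop :=
  ∀ (W : WeierstrassCurve ℚ) [W.IsElliptic] [W.IsGloballyMinimal] [NeZero (W.conductorNorm ℤ)]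
    (p : ℕ) [Fact p.Prime] (K : Type) [Field K] [NumberField K]
    (Dt : ModularParametrizationData W (W.conductorNorm ℤ)) (ι : K →+* ℂ)
    {N Nd : ℕ} [NeZero N] [NeZero Nd] (f : CuspForm (CongruenceSubgroup.Gamma0 N) 2)
    (fd : CuspForm (CongruenceSubgroup.Gamma0 Nd) 2) (k ℓ : ℕ) [NeZero ℓ]
    (ψ : (q : ℕ) → (ZMod q)ˣ →* Multiplicative (ZMod (p ^ k))) (h : TameHeight W K (p ^ k))
    (H : HeegnerDatum (W.conductorNorm ℤ) (NumberField.discr K))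
    (y P₀ T : (W.baseChange K).toAffine.Point) (I : ℤ) (s t : ℕ),
    IsNewformOf W f → IsNewformOf (W.quadraticTwist (NumberField.discr K : ℚ)) fd →
    InertKatoKolyvaginPrime W K p k ℓ → Function.Surjective (ψ ℓ) →
    WeierstrassCurve.Affine.Point.map ι.toRatAlgHom y = heegnerPointComplex Dt H →
    TameGrossZagierAt W p K Dt ι f fd k ℓ ψ h H y →
    y = I • P₀ + T → IsOfFinAddOrder T → I ≠ 0 →
    padicValNat p (AddSubgroup.zmultiples y).index = padicValInt p I →
    IsUnit (h.toFun P₀) →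
    ExactPPow p s (kuriharaNumber f (p ^ k) ℓ ψ) →
    ExactPPow p t (kuriharaNumber fd (p ^ k) 1 ψ) →
    s + t < k → 2 * padicValInt p I < k →
    s + t ≤ padicValNat p (W.baseChange K).shaOrder →
    Summit.BirchSwinnertonDyer.Rank1Residual.X11b.IndexLowerBoundAt W p K y

/-- **The engine statement the card proposes for S5** (shape only; the Kato-leg and Ш-decomposition
inputs are in print on the FW locus and enter `FirstLemma` as hypotheses): a tame-height family
`h k ℓ ψ` (the Nekovář construction, definition request D1) for which `TGZ_ℓ` holds at every level `k ≥ 1`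
and every inert KK prime `ℓ` of that level, on every frame of S5. Quantifying over a FAMILY given as
data (not `∃ h`) is deliberate: existence of the canonical height is the construction item, the
identity is the crux. -/
def TameGrossZagier
    (h : (W : WeierstrassCurve ℚ) → (K : Type) → [Field K] → [NumberField K] → (p k ℓ : ℕ) →
      ((q : ℕ) → (ZMod q)ˣ →* Multiplicative (ZMod (p ^ k))) → TameHeight W K (p ^ k)) : Prop :=
  ∀ (W : WeierstrassCurve ℚ) [W.IsElliptic] [W.IsGloballyMinimal] [NeZero (W.conductorNorm ℤ)]
    (p : ℕ) [Fact p.Prime] (K : Type) [Field K] [NumberField K]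
    (Dt : ModularParametrizationData W (W.conductorNorm ℤ)) (β : ℤ) (ι : K →+* ℂ)
    {N Nd : ℕ} [NeZero N] [NeZero Nd] (f : CuspForm (CongruenceSubgroup.Gamma0 N) 2)
    (fd : CuspForm (CongruenceSubgroup.Gamma0 Nd) 2) (k ℓ : ℕ) [NeZero ℓ]
    (ψ : (q : ℕ) → (ZMod q)ˣ →* Multiplicative (ZMod (p ^ k)))
    (H : HeegnerDatum (W.conductorNorm ℤ) (NumberField.discr K)) (y : (W.baseChange K).toAffine.Point),
    5 ≤ p → Addv W p → W.HasSurjectiveModNGaloisRep p → W.analyticRank = 1 →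
    IsImaginaryQuadratic K → Odd (NumberField.discr K) → NumberField.discr K < -4 →
    SatisfiesHeegnerHypothesis (W.conductorNorm ℤ) K →
    (W.quadraticTwist (NumberField.discr K : ℚ)).entireLFunction 1 ≠ 0 →
    (4 * (W.conductorNorm ℤ : ℤ)) ∣ β ^ 2 - NumberField.discr K → ¬ (p : ℤ) ∣ Dt.c → H.β = β → 1 ≤ k →
    TameGrossZagierAt W p K Dt ι f fd k ℓ ψ (h W K p k ℓ ψ) H y

end Summit.BirchSwinnertonDyer.BirchSwinnertonDyer.Cruxes.LevelKolyvaginSystemsAdditive.TameGrossZagier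

end
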